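import Summits.CriticalPhenomena.PercolationContinuityZ3.Theorems.PercNearOneGluingNoHeavyLowerTailThreePointProductFormFibrePendantLoops
import Summits.CriticalPhenomena.PercolationContinuityZ3.Theorems.PercNearOneGluingNoHeavyLowerTailThreePointProductFormFibreDangling
import Mathlib.Combinatorics.SimpleGraph.Acyclic
import HarnessLib

/-!
# The product form `#bad² ≤ #P1·#P2` in the fibre language: CONJECTURE (P) ON EVERY FOREST
# (Sahi programme, prover prim-sahi-p2 gen 54)

Support file (`--supports stmt-CriticalPhenomena-4575`, helper); continues `…FibreCutVertex`, `…FibrePendant`, `…FibreDangling`.  Standard axioms,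
no sorries, no named facts, no definitions.  Memo `run/shared/lean/prim/prim-sahi/FROM-prim-sahi-p2-gen54-CERTIFICATE-SHAPE.md` §8.

* (pendant-apex reduction with loops allowed at the apex: `…ThreePointProductFormFibrePendantLoops`, `productForm_of_pendant_gen`.)
* §2 — an apex carrying only loops has no bad configurations (`card_bad_eq_zero_of_loops`).
* §3 — the component `S` of `s` in the underlying graph minus `a` (walks of labels avoiding `a`): `a` separates `S` from the rest
  (`separates_component`), so `…FibreCutVertex` applies when `c ∉ S`, and `…FibreDangling` removes everything outside `S ∪ {a}` when `c ∈ S`.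
* §4 — **`productForm_of_isAcyclic`** [this work]: if the underlying simple graph `fromEdgeSet {e | ∃ l, ends l = e}` of the multigraph is
  ACYCLIC (a forest; parallel labels and loops allowed), then `#bad² ≤ #P1·#P2` for all `s, a, c` — CONJECTURE (P) ON FORESTS, by induction on the
  number of non-loop labels: in a forest the apex has at most one neighbour inside `S` (bridges), so after the dangling reduction it is pendant.
[folklore] (forests: every edge is a bridge); [cite: Gladkov2024, Conjecture 10.1 (p. 18), arXiv:2408.08457] for (P).
-/

namespace Summit.CriticalPhenomena.PercolationContinuityZ3.Theorems.ProductFormFibre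

open Finset Literature.Probability.Percolation
open Summit.CriticalPhenomena.PercolationContinuityZ3.Theorems.ThreePointCPIClusterSwap
  (QTouch clusterFlip clusterFlip_of_qtouch clusterFlip_of_not_qtouch)

variable {V α : Type*}

/-! ## §2. An apex carrying only loops has no bad configuration -/

section Loops

variable (ends : α → Sym2 V) (a : V)

/-- If every label at `a` is a loop, `a` has no open neighbour. [this work] -/
theorem not_adj_apex_of_loops (hloop : ∀ l, a ∈ ends l → (ends l).IsDiag) (z : α → Bool) (w : V) :
    ¬ (openGraph (labelledOpen ends z)).Adj a w := by
  intro hadj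
  rw [openGraph_adj] at hadj
  obtain ⟨⟨l, -, hle⟩, haw⟩ := hadj
  have hd := hloop l (by rw [hle]; exact Sym2.mem_mk_left a w)
  rw [hle] at hd
  exact haw (Sym2.mk_isDiag_iff.mp hd)

/-- If every label at `a` is a loop, `a` is joined to itself only. [this work] -/
theorem eq_of_reachable_apex_of_loops (hloop : ∀ l, a ∈ ends l → (ends l).IsDiag) (z : α → Bool) {v : V}
    (h : (openGraph (labelledOpen ends z)).Reachable a v) : v = a := by
  obtain ⟨p⟩ := h
  cases p with
  | nil => rfl
  | cons hadj _ => exact absurd hadj (not_adj_apex_of_loops ends a hloop z _)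

/-- If every label at `a` is a loop, the flat changes only loops, so it cannot create an `s–c` connection: NO configuration is bad.
[this work] -/
theorem not_bad_of_loops (hloop : ∀ l, a ∈ ends l → (ends l).IsDiag) (s c : V) (z : α → Bool)
    (hsc : ¬ (openGraph (labelledOpen ends z)).Reachable s c) :
    ¬ (openGraph (labelledOpen ends (clusterFlip ends a fun x => !z x))).Reachable s c := by
  classical
  rintro ⟨p⟩
  apply hsc
  refine reachable_of_walk_of_labels ends _ z p fun l hl he => ?_
  have heG := p.edges_subset_edgeSet he
  have hnd : ¬ (ends l).IsDiag := by
    rw [openGraph, SimpleGraph.edgeSet_fromEdgeSet] at heG; exact heG.2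
  have hal : a ∉ ends l := fun h => hnd (hloop l h)
  have hq : ¬ QTouch ends a (fun x => !z x) l := by
    rw [qtouch_compl_iff]
    rintro ⟨v, hv, hr⟩
    exact hal ((eq_of_reachable_apex_of_loops ends a hloop z hr) ▸ hv)
  rw [clusterFlip_of_not_qtouch ends a _ hq, Bool.not_not] at hl
  exact hl

end Loops

/-! ## §3. The component of `s` away from the apex, in the graph of all labels -/

section Component

variable (ends : α → Sym2 V) (a s : V)

/-- `a` is not in the component of `s` computed with walks avoiding `a`. [this work] -/
theorem apex_not_mem_component :
    a ∉ {v : V | ∃ p : (SimpleGraph.fromEdgeSet {e : Sym2 V | ∃ l, ends l = e}).Walk s v, a ∉ p.support} := by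
  rintro ⟨p, hp⟩
  exact hp p.end_mem_support

/-- `s ≠ a` lies in its own component. [this work] -/
theorem mem_component_self (hsa : s ≠ a) :
    s ∈ {v : V | ∃ p : (SimpleGraph.fromEdgeSet {e : Sym2 V | ∃ l, ends l = e}).Walk s v, a ∉ p.support} := by
  refine ⟨SimpleGraph.Walk.nil, ?_⟩
  rw [SimpleGraph.Walk.support_nil, List.mem_singleton]
  exact fun h => hsa h.symm

/-- One step of a label away from `a` stays in the component. [this work] -/
theorem mem_component_of_adj {u w : V}
    (hu : u ∈ {v : V | ∃ p : (SimpleGraph.fromEdgeSet {e : Sym2 V | ∃ l, ends l = e}).Walk s v, a ∉ p.support})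
    (hadj : (SimpleGraph.fromEdgeSet {e : Sym2 V | ∃ l, ends l = e}).Adj u w) (hwa : w ≠ a) :
    w ∈ {v : V | ∃ p : (SimpleGraph.fromEdgeSet {e : Sym2 V | ∃ l, ends l = e}).Walk s v, a ∉ p.support} := by
  obtain ⟨p, hp⟩ := hu
  refine ⟨p.concat hadj, ?_⟩
  rw [SimpleGraph.Walk.support_concat]
  simp only [List.mem_append, List.mem_singleton, not_or]
  exact ⟨hp, fun h => hwa h.symm⟩

/-- **The apex separates the component of `s` from the rest**: every label lies inside `S ∪ {a}` or inside `Sᶜ ∪ {a}`. [this work] -/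
theorem separates_component :
    ∀ l : α, (∀ v ∈ ends l, v ∈ {v : V | ∃ p : (SimpleGraph.fromEdgeSet {e : Sym2 V | ∃ l, ends l = e}).Walk s v, a ∉ p.support} ∨ v = a) ∨
      (∀ v ∈ ends l, v ∉ {v : V | ∃ p : (SimpleGraph.fromEdgeSet {e : Sym2 V | ∃ l, ends l = e}).Walk s v, a ∉ p.support} ∨ v = a) := by
  classical
  intro l
  set S := {v : V | ∃ p : (SimpleGraph.fromEdgeSet {e : Sym2 V | ∃ l, ends l = e}).Walk s v, a ∉ p.support} with hS
  obtain ⟨u, w, hends⟩ : ∃ u w, ends l = s(u, w) := by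
    induction ends l using Sym2.ind with
    | h u w => exact ⟨u, w, rfl⟩
  by_cases huw : u = w
  · subst huw
    by_cases hu : u ∈ S ∨ u = a
    · left; intro v hv; rw [hends, Sym2.mem_iff, or_self] at hv; exact hv ▸ hu
    · right; intro v hv; rw [hends, Sym2.mem_iff, or_self] at hv; subst hv
      exact Or.inl fun h => hu (Or.inl h)
  · have hadj : (SimpleGraph.fromEdgeSet {e : Sym2 V | ∃ l, ends l = e}).Adj u w := by
      rw [SimpleGraph.fromEdgeSet_adj]; exact ⟨⟨l, hends⟩, huw⟩
    by_cases hu : u ∈ S ∨ u = a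
    · by_cases hw : w ∈ S ∨ w = a
      · left; intro v hv; rw [hends, Sym2.mem_iff] at hv
        rcases hv with rfl | rfl
        · exact hu
        · exact hw
      · -- `w ∉ S`, `w ≠ a`: then `u` cannot be in `S` either
        right; intro v hv; rw [hends, Sym2.mem_iff] at hv
        rcases hv with rfl | rfl
        · rcases hu with hu | hu
          · exact absurd (mem_component_of_adj ends a s hu hadj fun h => hw (Or.inr h)) fun h => hw (Or.inl h)
          · exact Or.inr hu
        · exact Or.inl fun h => hw (Or.inl h)
    · right; intro v hv; rw [hends, Sym2.mem_iff] at hv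
      rcases hv with rfl | rfl
      · exact Or.inl fun h => hu (Or.inl h)
      · by_cases hwa : v = a
        · exact Or.inr hwa
        · left; intro hw
          exact hu (Or.inl (mem_component_of_adj ends a s hw hadj.symm fun h => hu (Or.inr h)))

/-- **In a forest the apex has at most one neighbour in the component of `s`** (two neighbours `x ≠ y` in `S` and the path between
them avoiding `a` would make the edge `a–x` a non-bridge). [this work] -/
theorem eq_of_adj_of_mem_component [DecidableEq V]
    (hac : (SimpleGraph.fromEdgeSet {e : Sym2 V | ∃ l, ends l = e}).IsAcyclic) {x y : V}
    (hx : x ∈ {v : V | ∃ p : (SimpleGraph.fromEdgeSet {e : Sym2 V | ∃ l, ends l = e}).Walk s v, a ∉ p.support})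
    (hy : y ∈ {v : V | ∃ p : (SimpleGraph.fromEdgeSet {e : Sym2 V | ∃ l, ends l = e}).Walk s v, a ∉ p.support})
    (hax : (SimpleGraph.fromEdgeSet {e : Sym2 V | ∃ l, ends l = e}).Adj a x)
    (hay : (SimpleGraph.fromEdgeSet {e : Sym2 V | ∃ l, ends l = e}).Adj a y) : x = y := by
  by_contra hxy
  obtain ⟨p, hp⟩ := hx
  obtain ⟨q, hq⟩ := hy
  have hbridge := (SimpleGraph.isAcyclic_iff_forall_adj_isBridge.mp hac) hax
  rw [SimpleGraph.isBridge_iff] at hbridge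
  apply hbridge
  -- the walk `a → y → s → x` avoids the edge `a–x`
  let r : (SimpleGraph.fromEdgeSet {e : Sym2 V | ∃ l, ends l = e}).Walk y x := q.reverse.append p
  have hr : a ∉ r.support := by
    intro h
    rw [SimpleGraph.Walk.mem_support_append_iff, SimpleGraph.Walk.support_reverse, List.mem_reverse] at h
    rcases h with h | h
    · exact hq h
    · exact hp h
  let w : (SimpleGraph.fromEdgeSet {e : Sym2 V | ∃ l, ends l = e}).Walk a x := SimpleGraph.Walk.cons hay r
  refine ⟨w.toDeleteEdges {s(a, x)} ?_⟩
  intro e he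
  rw [SimpleGraph.Walk.edges_cons, List.mem_cons] at he
  rw [Set.mem_singleton_iff]
  rcases he with rfl | he
  · intro h
    have : y = x := by
      have hmem : y ∈ (s(a, x) : Sym2 V) := by rw [← h]; exact Sym2.mem_mk_right a y
      rcases Sym2.mem_iff.1 hmem with h1 | h1
      · exact absurd h1 hay.ne.symm
      · exact h1
    exact hxy this.symm
  · intro h
    rw [h] at he
    exact hr (r.fst_mem_support_of_mem_edges he)

end Component


/-! ## §4. CONJECTURE (P) on every forest -/

section Forest

variable [Fintype α] [DecidableEq α] [DecidableEq V]

omit [DecidableEq V] in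
open Classical in
/-- If no configuration is bad, (P) holds trivially. [this work] -/
theorem productForm_of_not_bad (ends : α → Sym2 V) (a s c : V)
    (h : ∀ z : α → Bool, ¬ ((¬ (openGraph (labelledOpen ends z)).Reachable a s ∧ ¬ (openGraph (labelledOpen ends z)).Reachable a c ∧
          ¬ (openGraph (labelledOpen ends z)).Reachable s c) ∧
        (openGraph (labelledOpen ends (clusterFlip ends a fun x => !z x))).Reachable s c)) :
    (univ.filter fun z : α → Bool =>
        (¬ (openGraph (labelledOpen ends z)).Reachable a s ∧ ¬ (openGraph (labelledOpen ends z)).Reachable a c ∧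
          ¬ (openGraph (labelledOpen ends z)).Reachable s c) ∧
        (openGraph (labelledOpen ends (clusterFlip ends a fun x => !z x))).Reachable s c).card ^ 2 ≤
    (univ.filter fun z : α → Bool =>
        (openGraph (labelledOpen ends z)).Reachable a s ∧ ¬ (openGraph (labelledOpen ends z)).Reachable a c).card *
    (univ.filter fun z : α → Bool =>
        (openGraph (labelledOpen ends z)).Reachable a c ∧ ¬ (openGraph (labelledOpen ends z)).Reachable a s).card := by
  have he : (univ.filter fun z : α → Bool =>
        (¬ (openGraph (labelledOpen ends z)).Reachable a s ∧ ¬ (openGraph (labelledOpen ends z)).Reachable a c ∧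
          ¬ (openGraph (labelledOpen ends z)).Reachable s c) ∧
        (openGraph (labelledOpen ends (clusterFlip ends a fun x => !z x))).Reachable s c) = ∅ :=
    Finset.filter_eq_empty_iff.mpr fun z _ => h z
  rw [he, Finset.card_empty, zero_pow two_ne_zero]
  exact Nat.zero_le _

open Classical in
/-- The induction behind `productForm_of_isAcyclic`: on the number of non-loop labels. [this work] -/
theorem productForm_of_isAcyclic_aux : ∀ (n : ℕ) (ends : α → Sym2 V),
    (univ.filter fun l : α => ¬ (ends l).IsDiag).card ≤ n →
    (SimpleGraph.fromEdgeSet {e : Sym2 V | ∃ l, ends l = e}).IsAcyclic →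
    ∀ s a c : V,
    (univ.filter fun z : α → Bool =>
        (¬ (openGraph (labelledOpen ends z)).Reachable a s ∧ ¬ (openGraph (labelledOpen ends z)).Reachable a c ∧
          ¬ (openGraph (labelledOpen ends z)).Reachable s c) ∧
        (openGraph (labelledOpen ends (clusterFlip ends a fun x => !z x))).Reachable s c).card ^ 2 ≤
    (univ.filter fun z : α → Bool =>
        (openGraph (labelledOpen ends z)).Reachable a s ∧ ¬ (openGraph (labelledOpen ends z)).Reachable a c).card *
    (univ.filter fun z : α → Bool =>
        (openGraph (labelledOpen ends z)).Reachable a c ∧ ¬ (openGraph (labelledOpen ends z)).Reachable a s).card := by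
  intro n
  induction n with
  | zero =>
    intro ends hcard _ s a c
    have hall : ∀ l, (ends l).IsDiag := by
      intro l
      have h0 := Finset.card_eq_zero.mp (Nat.le_zero.mp hcard)
      have := Finset.filter_eq_empty_iff.mp h0 (Finset.mem_univ l)
      exact not_not.mp this
    exact productForm_of_not_bad ends a s c fun z hz =>
      not_bad_of_loops ends a (fun l _ => hall l) s c z hz.1.2.2 hz.2
  | succ n ih =>
    intro ends hcard hac s a c
    -- degenerate terminal positions
    by_cases hsa : s = a
    · subst hsa
      exact productForm_of_not_bad ends s s c fun z hz => hz.1.1 (SimpleGraph.Reachable.refl _)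
    by_cases hca : c = a
    · subst hca
      exact productForm_of_not_bad ends c s c fun z hz => hz.1.2.1 (SimpleGraph.Reachable.refl _)
    -- the component of `s` away from `a` in the graph of all labels
    set S : Set V := {v : V | ∃ p : (SimpleGraph.fromEdgeSet {e : Sym2 V | ∃ l, ends l = e}).Walk s v, a ∉ p.support} with hS
    have hsep := separates_component ends a s
    have haS : a ∉ S := apex_not_mem_component ends a s
    have hsS : s ∈ S := mem_component_self ends a s hsa
    by_cases hcS : c ∈ S
    swap
    · -- `a` separates `s` from `c`: the cut-vertex theorem
      exact productForm_of_separates ends a s c S hsep haS hsS hcS hca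
    -- `s, c` on the same side: remove everything outside `S ∪ {a}` (dangling parts)
    let inD : α → Prop := fun l => ¬ ∀ v ∈ ends l, v ∈ S ∨ v = a
    have hD1 : ∀ l, inD l → ∀ v ∈ ends l, v ∈ {v : V | v ∉ S ∧ v ≠ a} ∨ v = a := by
      intro l hin v hv
      rcases hsep l with h | h
      · exact absurd h hin
      · by_cases hva : v = a
        · exact Or.inr hva
        · rcases h v hv with h' | h'
          · exact Or.inl ⟨h', hva⟩
          · exact absurd h' hva
    have hD2 : ∀ l, ¬ inD l → ∀ v ∈ ends l, v ∉ {v : V | v ∉ S ∧ v ≠ a} ∨ v = a := by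
      intro l hin v hv
      have hin' : ∀ v ∈ ends l, v ∈ S ∨ v = a := not_not.mp hin
      rcases hin' v hv with h | h
      · exact Or.inl fun h' => h'.1 h
      · exact Or.inr h
    refine productForm_of_dangling ends a s c {v : V | v ∉ S ∧ v ≠ a} inD hD1 hD2
      ⟨fun h' => h'.1 hsS, hsa⟩ ⟨fun h' => h'.1 hcS, hca⟩ ?_
    -- in the reduced multigraph `ends°` the apex is pendant (forest!) or carries only loops
    by_cases hnb : ∃ l, ¬ (ends l).IsDiag ∧ a ∈ ends l ∧ ¬ inD l
    swap
    · -- only loops at `a` in `ends°`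
      refine productForm_of_not_bad _ a s c fun z hz => not_bad_of_loops _ a ?_ s c z hz.1.2.2 hz.2
      intro l hal
      by_cases hin : inD l
      · rw [if_pos hin]; exact Sym2.mk_isDiag_iff.mpr rfl
      · rw [if_neg hin] at hal ⊢
        by_contra hnd
        exact hnb ⟨l, hnd, hal, hin⟩
    obtain ⟨l₁, hnd₁, ha₁, hin₁⟩ := hnb
    obtain ⟨h, hl₁⟩ := Sym2.mem_iff_exists.mp ha₁
    have hha : h ≠ a := by
      intro hh; apply hnd₁; rw [hl₁, hh]; exact Sym2.mk_isDiag_iff.mpr rfl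
    have hin₁' : ∀ v ∈ ends l₁, v ∈ S ∨ v = a := not_not.mp hin₁
    have hhS : h ∈ S := (hin₁' h (by rw [hl₁]; exact Sym2.mem_mk_right a h)).resolve_right hha
    have hadj_h : (SimpleGraph.fromEdgeSet {e : Sym2 V | ∃ l, ends l = e}).Adj a h := by
      rw [SimpleGraph.fromEdgeSet_adj]; exact ⟨⟨l₁, hl₁⟩, hha.symm⟩
    -- every label of `ends°` at `a` is `a–h` or a loop
    have hpend : ∀ l, (a ∈ (@ite (Sym2 V) (inD l) (Classical.propDecidable _) s(a, a) (ends l))) →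
        (@ite (Sym2 V) (inD l) (Classical.propDecidable _) s(a, a) (ends l)) = s(a, h) ∨
          (@ite (Sym2 V) (inD l) (Classical.propDecidable _) s(a, a) (ends l)).IsDiag := by
      intro l hal
      by_cases hin : inD l
      · simp only [hin, if_true] at hal ⊢
        exact Or.inr (Sym2.mk_isDiag_iff.mpr rfl)
      · simp only [hin, if_false] at hal ⊢
        have hins : ∀ v ∈ ends l, v ∈ S ∨ v = a := not_not.mp hin
        obtain ⟨x, hx⟩ := Sym2.mem_iff_exists.mp hal
        by_cases hxa : x = a
        · right; rw [hx, hxa]; exact Sym2.mk_isDiag_iff.mpr rfl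
        · left
          have hxS : x ∈ S := (hins x (by rw [hx]; exact Sym2.mem_mk_right a x)).resolve_right hxa
          have hadj_x : (SimpleGraph.fromEdgeSet {e : Sym2 V | ∃ l, ends l = e}).Adj a x := by
            rw [SimpleGraph.fromEdgeSet_adj]; exact ⟨⟨l, hx⟩, Ne.symm hxa⟩
          rw [hx, eq_of_adj_of_mem_component ends a s hac hxS hhS hadj_x hadj_h]
    refine productForm_of_pendant_gen _ a h s c hha hpend hsa hca ?_
    -- the doubly reduced multigraph has fewer non-loop labels and is still a forest: induction
    refine ih _ ?_ ?_ s h c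
    · -- non-loop labels of `ends°°` are non-loop labels of `ends` other than `l₁`
      have hsub : (univ.filter fun l : α => ¬ (if a ∈ (@ite (Sym2 V) (inD l) (Classical.propDecidable _) s(a, a) (ends l)) then s(h, h)
            else (@ite (Sym2 V) (inD l) (Classical.propDecidable _) s(a, a) (ends l))).IsDiag) ⊆
          (univ.filter fun l : α => ¬ (ends l).IsDiag).erase l₁ := by
        intro l hl
        rw [Finset.mem_filter] at hl
        rw [Finset.mem_erase, Finset.mem_filter]
        have hl2 := hl.2
        refine ⟨?_, Finset.mem_univ _, ?_⟩
        · rintro rfl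
          apply hl2
          simp only [hin₁, if_false, ha₁, if_true]
          exact Sym2.mk_isDiag_iff.mpr rfl
        · intro hd
          apply hl2
          by_cases hin : inD l
          · simp only [hin, if_true]
            by_cases haa : a ∈ (s(a, a) : Sym2 V)
            · simp only [haa, if_true]; exact Sym2.mk_isDiag_iff.mpr rfl
            · simp only [haa, if_false]; exact Sym2.mk_isDiag_iff.mpr rfl
          · simp only [hin, if_false]
            by_cases hal : a ∈ ends l
            · simp only [hal, if_true]; exact Sym2.mk_isDiag_iff.mpr rfl
            · simp only [hal, if_false]; exact hd
      calc _ ≤ ((univ.filter fun l : α => ¬ (ends l).IsDiag).erase l₁).card := Finset.card_le_card hsub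
        _ = (univ.filter fun l : α => ¬ (ends l).IsDiag).card - 1 :=
            Finset.card_erase_of_mem (by rw [Finset.mem_filter]; exact ⟨Finset.mem_univ _, hnd₁⟩)
        _ ≤ n := by omega
    · -- still a forest: the graph of all labels only shrank
      refine hac.anti fun u v huv => ?_
      rw [SimpleGraph.fromEdgeSet_adj] at huv ⊢
      obtain ⟨⟨l, hl⟩, hne⟩ := huv
      refine ⟨?_, hne⟩
      by_cases hin : inD l
      · exfalso; apply hne
        simp only [hin, if_true] at hl
        by_cases haa : a ∈ (s(a, a) : Sym2 V)
        · simp only [haa, if_true] at hl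
          have h1 : u ∈ (s(h, h) : Sym2 V) := by rw [hl]; exact Sym2.mem_mk_left u v
          have h2 : v ∈ (s(h, h) : Sym2 V) := by rw [hl]; exact Sym2.mem_mk_right u v
          rw [Sym2.mem_iff, or_self] at h1 h2; rw [h1, h2]
        · simp only [haa, if_false] at hl
          have h1 : u ∈ (s(a, a) : Sym2 V) := by rw [hl]; exact Sym2.mem_mk_left u v
          have h2 : v ∈ (s(a, a) : Sym2 V) := by rw [hl]; exact Sym2.mem_mk_right u v
          rw [Sym2.mem_iff, or_self] at h1 h2; rw [h1, h2]
      · simp only [hin, if_false] at hl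
        by_cases hal : a ∈ ends l
        · exfalso; apply hne
          simp only [hal, if_true] at hl
          have h1 : u ∈ (s(h, h) : Sym2 V) := by rw [hl]; exact Sym2.mem_mk_left u v
          have h2 : v ∈ (s(h, h) : Sym2 V) := by rw [hl]; exact Sym2.mem_mk_right u v
          rw [Sym2.mem_iff, or_self] at h1 h2; rw [h1, h2]
        · simp only [hal, if_false] at hl
          exact ⟨l, hl⟩

open Classical in
/-- **CONJECTURE (P) ON EVERY FOREST.**  If the graph of all labels of the finite multigraph `(V, α, ends)` is acyclic (a forest; parallel
labels and loops allowed), then for all `s, a, c`:  `#{a ↮ s, a ↮ c, s ↮ c in z, s ↔ c in ♭z}² ≤ #{a ↔ s, a ↮ c} · #{a ↔ c, a ↮ s}`,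
`♭z = clusterFlip ends a z̄`. [this work] -/
theorem productForm_of_isAcyclic (ends : α → Sym2 V)
    (hac : (SimpleGraph.fromEdgeSet {e : Sym2 V | ∃ l, ends l = e}).IsAcyclic) (s a c : V) :
    (univ.filter fun z : α → Bool =>
        (¬ (openGraph (labelledOpen ends z)).Reachable a s ∧ ¬ (openGraph (labelledOpen ends z)).Reachable a c ∧
          ¬ (openGraph (labelledOpen ends z)).Reachable s c) ∧
        (openGraph (labelledOpen ends (clusterFlip ends a fun x => !z x))).Reachable s c).card ^ 2 ≤
    (univ.filter fun z : α → Bool =>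
        (openGraph (labelledOpen ends z)).Reachable a s ∧ ¬ (openGraph (labelledOpen ends z)).Reachable a c).card *
    (univ.filter fun z : α → Bool =>
        (openGraph (labelledOpen ends z)).Reachable a c ∧ ¬ (openGraph (labelledOpen ends z)).Reachable a s).card :=
  productForm_of_isAcyclic_aux _ ends le_rfl hac s a c

end Forest


end Summit.CriticalPhenomena.PercolationContinuityZ3.Theorems.ProductFormFibre
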